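import Summits.BirchSwinnertonDyer.Rank1Residual.AdditivePotMult.RankZeroKimNakamuraImprimitiveDefect
import Summits.BirchSwinnertonDyer.Rank1Residual.AdditivePotMult.RankZeroKimNakamuraImprimitive
import Summits.BirchSwinnertonDyer.Rank1Residual.AdditivePotMult.RankZeroShaEightyOneCertificateIntModel
import HarnessLib

/-!
# The Kim–Nakamura road on X4(M)@3 r0 on a LITERAL integer model: the kernel-decidable binders
# (`ClassX4M W 3`, `3 ∤ ord₃ j`, NOT exceptional at `3`) from the a-invariants, and the RECORD SHAPE
# (cell `b2b-bsdres`, sub-cell additive-p1, gen 18; per-pair consumer, template of records — none filed)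

HONEST FRAMING (cell `b2b-bsdres`, run/shared/lean/b2b/bsd-rank1-residual/, verbatim in every
file): the goal of the cell is to DELETE the COMBINATION-SHAPED residual classes of the
Birch–Swinnerton-Dyer formula for ALL analytic-rank `≤ 1` elliptic curves over `ℚ` — "full BSD
formula for every rank `≤ 1` curve in class `C`" assembled STRICTLY from published theorems — so
that the rank-`≤ 1` remainder becomes exactly the CONSTRUCTION-SHAPED classes, which are TYPED
(missing-input `Prop`s), NOT attempted. This is not "finishing BSD". X3♯(M)/X4(M) stay
CONSTRUCTION-SHAPED; per-pair consumer; nothing booked (the lane books, the referee signs); no record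
is filed here. THEOREMS ONLY (no definition, no named fact, no `sorry`).

## What this file does

The companions `RankZeroKimNakamuraImprimitive.lean` (A153 road) and
`RankZeroKimNakamuraImprimitiveDefect.lean` (A153′ + Cassels–Tate parity) close an X4(M) ∧ surj(3) ∧
`r_an = 0` pair at `3` from per-pair binders. Three of those binders are DECIDABLE from the integer
a-invariants of the globally minimal model `E₀ = integralModelInt W`, and this file decides them:
* `ClassX4M W 3` — gen 17 (`classX4M_of_intModel_of_surj`: `3 ∣ Δ`, `3 ∣ c₄`, `3^{k+1} ∤ c₄³`,
  `3^{k+1} ∣ Δ`, given surj(3));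
* §1 `ord_p j(E)` EXACTLY from the model (`padicValRat_j_eq_of_intModel`: `3^a ∥ c₄`, `3^b ∥ Δ` ⟹
  `ord₃ j = 3a − b`) — whence the kernel-surj bit `3 ∤ ord₃ j` (`not_dvd_padicValRat_j_of_intModel`);
* §1 NOT exceptional at `3` (Kim–Nakamura Assumption 2.5 / Kosters–Pannekoek) from an INTEGER translate
  certificate `(r, s, t; b₁, b₂, b₃, b₄, b₆)` with `b₂ ≢ 2 (mod 3)`
  (`nonExceptional_three_of_intModel`, the integer form of lit-kato's `nonExceptional_three_of_translate`).
§2 RECORD SHAPES at `p = 3`: `bsdp_three_of_intModel_of_surj_of_kimNakamura_of_shaAn_unit` (A153,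
defect `0`) and `bsdp_three_of_intModel_of_surj_of_kimNakamuraImprimitive_of_defect_le_one_of_shaAn_unit`
(A153′ + parity, defect `≤ 1`): the remaining displayed binders per row are surj(3) (a `surj3_v<label>`
theorem of the records seats), `r_an = 0`, `3 ∤ ∏ c_ℓ`, the `(ℓ ∓ 1)` clause resp. the defect data
`(S, d, Σ d ≤ 1)`, a parametrisation datum with `3 ∤ c` (or `3 ∤ deg φ` via the companions' degree
forms), `#Ш_an` a `3`-unit, and the named facts `hKN`/`hKNI`, `hGZK`, `hmod` (+ `hCT`).
§3 ONE worked instance of the decidable part, Cremona `1098c1 = [1, −1, 0, −63864, 6229696]`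
(`N = 1098 = 2·3²·61`, `v₃(c₄) = 2`, `v₃(Δ) = 19`, `ord₃ j = −13`; translate `(r,s,t) = (2,1,2)`,
`b₂ = 1`; census row: defect `D = 1`, `3 ∤ ∏c`, `#Ш_an = 1`): `nonExceptional_three_v1098c1`,
`padicValRat_j_three_v1098c1`, `classX4M_three_v1098c1` (given surj(3)). No BSD statement for the curve
is asserted (its `r_an`, `∏c`, defect and `#Ш_an` are lane data, displayed as binders in §2).

References: Kim–Nakamura 2020 [KimNakamura2020] Rem. 1.8 (1)(4), Assumption 2.5 with (2.1);
Kosters–Pannekoek [KostersPannekoek2017] Cor. 2; Silverman *AEC* III.1 (`j = c₄³/Δ`), VII.5.1 (c),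
X.4.14; Wuthrich 2014 Lemma 20; Miller 2011 Def. 1.1.
-/

noncomputable section

open scoped Classical

open WeierstrassCurve Literature.NumberTheory.EllipticCurves
  Literature.NumberTheory.EllipticCurves.ModularForms
  Literature.NumberTheory.EllipticCurves.Rank1Residual
  Literature.NumberTheory.EllipticCurves.Rank1Residual.Typed
  Summit.BirchSwinnertonDyer.BirchSwinnertonDyer.Rank1Residual

namespace Summit.BirchSwinnertonDyer.Rank1Residual.AdditivePotMult

/-! ### §1 Deciders on the integer model: `ord_p j` exactly, and NOT exceptional at `3` -/

section IntModel

variable {W : WeierstrassCurve ℚ} [W.IsElliptic] [W.IsGloballyMinimal] {E₀ : WeierstrassCurve ℤ}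
  (hI : integralModelInt W = E₀)
include hI

omit [W.IsElliptic] in
/-- The rational model IS the cast of its integer model. [folklore] -/
theorem eq_map_of_intModel : W = E₀.map (Int.castRingHom ℚ) := by
  rw [← hI, map_integralModelInt]

/-- **`ord_p j(W) = 3a − b` from the integer model** when `p^a ∥ c₄(E₀)` and `p^b ∥ Δ(E₀)`
(`j = c₄³/Δ`, Silverman *AEC* III.1). [cite: SilvermanAEC2009, III.1 (p. 42)] -/
theorem padicValRat_j_eq_of_intModel (p : ℕ) [hp : Fact p.Prime] (a b : ℕ)
    (hca : (p : ℤ) ^ a ∣ E₀.c₄) (hca' : ¬ (p : ℤ) ^ (a + 1) ∣ E₀.c₄)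
    (hΔb : (p : ℤ) ^ b ∣ E₀.Δ) (hΔb' : ¬ (p : ℤ) ^ (b + 1) ∣ E₀.Δ) :
    padicValRat p W.j = 3 * a - b := by
  have hΔ0 : E₀.Δ ≠ 0 := fun h => hΔb' (h ▸ dvd_zero _)
  have hc0 : E₀.c₄ ≠ 0 := fun h => hca' (h ▸ dvd_zero _)
  have hΔ0' : ((E₀.Δ : ℤ) : ℚ) ≠ 0 := by exact_mod_cast hΔ0
  have hc0' : ((E₀.c₄ : ℤ) : ℚ) ≠ 0 := by exact_mod_cast hc0
  have hj : W.j = ((E₀.c₄ : ℤ) : ℚ) ^ 3 / ((E₀.Δ : ℤ) : ℚ) := by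
    rw [WeierstrassCurve.j, Units.val_inv_eq_inv_val, coe_Δ', IntModel.Δ_eq_cast hI,
      IntModel.c₄_eq_cast hI, div_eq_inv_mul]
  rw [hj, padicValRat.div (pow_ne_zero 3 hc0') hΔ0', padicValRat.pow ((E₀.c₄ : ℤ) : ℚ), padicValRat.of_int,
    padicValRat.of_int, IntModel.padicValInt_eq_of_dvd_of_not_dvd p hca hca',
    IntModel.padicValInt_eq_of_dvd_of_not_dvd p hΔb hΔb']
  push_cast
  ring

/-- **`p ∤ ord_p j(W)`** from the integer model: `p^a ∥ c₄`, `p^b ∥ Δ` and `p ∤ 3a − b`. At `p = 3`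
this is `3 ∤ b = ord₃ Δ`. (The kernel-surj bit on X4(M): `ClassX4M.surj_of_not_dvd_padicValRat_j`.)
[cite: SilvermanAEC2009, III.1 (p. 42)] -/
theorem not_dvd_padicValRat_j_of_intModel (p : ℕ) [hp : Fact p.Prime] (a b : ℕ)
    (hca : (p : ℤ) ^ a ∣ E₀.c₄) (hca' : ¬ (p : ℤ) ^ (a + 1) ∣ E₀.c₄)
    (hΔb : (p : ℤ) ^ b ∣ E₀.Δ) (hΔb' : ¬ (p : ℤ) ^ (b + 1) ∣ E₀.Δ)
    (h : ¬ (p : ℤ) ∣ (3 * a - b : ℤ)) : ¬ (p : ℤ) ∣ padicValRat p W.j := by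
  rwa [padicValRat_j_eq_of_intModel hI p a b hca hca' hΔb hΔb']

omit [W.IsElliptic] in
/-- **NOT exceptional at `3` (Kim–Nakamura Assumption 2.5 / Kosters–Pannekoek Cor. 2) from an INTEGER
translate certificate**: integers `r, s, t` and `b₁, b₂, b₃, b₄, b₆` with the translated coefficients
of `E₀` equal to `3 bᵢ` and `b₂ ≢ 2 (mod 3)` (i.e. `a₂' ≢ 6 (mod 9)`). Each hypothesis is a closed
integer identity (`decide` / `norm_num` on a literal model); the conclusion is lit-kato's
`KimNakamura2020.nonExceptional_three_of_translate` on the rational model.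
[cite: KimNakamura2020, Assumption 2.5 with (2.1) (arXiv p. 5)] [cite: KostersPannekoek2017, Cor. 2] -/
theorem nonExceptional_three_of_intModel (r s t b₁ b₂ b₃ b₄ b₆ : ℤ)
    (h₁ : E₀.a₁ + 2 * s = 3 * b₁)
    (h₂ : E₀.a₂ - s * E₀.a₁ + 3 * r - s ^ 2 = 3 * b₂)
    (h₃ : E₀.a₃ + r * E₀.a₁ + 2 * t = 3 * b₃)
    (h₄ : E₀.a₄ - s * E₀.a₃ + 2 * r * E₀.a₂ - (t + r * s) * E₀.a₁ + 3 * r ^ 2 - 2 * s * t = 3 * b₄)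
    (h₆ : E₀.a₆ + r * E₀.a₄ + r ^ 2 * E₀.a₂ + r ^ 3 - t * E₀.a₃ - t ^ 2 - r * t * E₀.a₁ = 3 * b₆)
    (hb : ¬ (3 : ℤ) ∣ b₂ - 2) : KimNakamura2020.NonExceptional W 3 := by
  have hW := eq_map_of_intModel hI
  have ha₁ : W.a₁ = (E₀.a₁ : ℚ) := by rw [hW]; simp
  have ha₂ : W.a₂ = (E₀.a₂ : ℚ) := by rw [hW]; simp
  have ha₃ : W.a₃ = (E₀.a₃ : ℚ) := by rw [hW]; simp
  have ha₄ : W.a₄ = (E₀.a₄ : ℚ) := by rw [hW]; simp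
  have ha₆ : W.a₆ = (E₀.a₆ : ℚ) := by rw [hW]; simp
  refine KimNakamura2020.nonExceptional_three_of_translate W r s t b₁ b₂ b₃ b₄ b₆ ?_ ?_ ?_ ?_ ?_ hb
  · rw [ha₁]; exact_mod_cast h₁
  · rw [ha₂, ha₁]; exact_mod_cast h₂
  · rw [ha₃, ha₁]; exact_mod_cast h₃
  · rw [ha₄, ha₃, ha₂, ha₁]; exact_mod_cast h₄
  · rw [ha₆, ha₄, ha₂, ha₃, ha₁]; exact_mod_cast h₆

end IntModel

/-! ### §2 RECORD SHAPES at `p = 3` (literal model; no record filed here) -/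

section RecordShape

variable {W : WeierstrassCurve ℚ} [W.IsElliptic] [W.IsGloballyMinimal] {E₀ : WeierstrassCurve ℤ}

/-- **RECORD SHAPE (A153 road, defect `0`), `p = 3`.** For a globally minimal elliptic `W/ℚ` with
integer model `E₀` (`hI`): `3 ∣ Δ`, `3 ∣ c₄`, `3^{k+1} ∤ c₄³`, `3^{k+1} ∣ Δ` (⇒ `ClassX4M W 3` given
surj(3)), an integer translate certificate of non-exceptionality (§1), `ρ̄_{E,3}` onto (a
`surj3_v<label>` theorem), `r_an = 0`, `3 ∤ ∏ c_ℓ`, the `(ℓ ∓ 1)` clause, a parametrisation datum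
with `3 ∤ c`, `#Ш(E)_an = q` a `3`-unit ⟹ `BSD(E,3)`. Named facts: `hKN` (A153), `hGZK`, `hmod`.
Per pair; nothing booked. [cite: KimNakamura2020, Thm. 1.7 and Rem. 1.8 (1) (arXiv p. 4); Assumption 2.5 (arXiv p. 5)]
[cite: SilvermanAEC2009, VII.5 Prop. 5.1 (c) and III.1] [cite: Miller2011LMS, §1 and Def. 1.1] -/
theorem bsdp_three_of_intModel_of_surj_of_kimNakamura_of_shaAn_unit
    (hI : integralModelInt W = E₀)
    (hKN : KimNakamura2020.rankZero_padicValNat_sha_le_of_maninConstant)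
    (hGZK : rank_eq_analyticRank_of_analyticRank_le_one) (hmod : hasEntireLFunction_rat)
    -- `ClassX4M W 3` from the model, given surj(3)
    (hΔ3 : (3 : ℤ) ∣ E₀.Δ) (hc₄3 : (3 : ℤ) ∣ E₀.c₄) (k : ℕ) (hck : ¬ (3 : ℤ) ^ (k + 1) ∣ E₀.c₄ ^ 3)
    (hΔk : (3 : ℤ) ^ (k + 1) ∣ E₀.Δ) (hsurj : W.HasSurjectiveModNGaloisRep 3)
    -- non-exceptionality certificate
    (r s t b₁ b₂ b₃ b₄ b₆ : ℤ)
    (h₁ : E₀.a₁ + 2 * s = 3 * b₁)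
    (h₂ : E₀.a₂ - s * E₀.a₁ + 3 * r - s ^ 2 = 3 * b₂)
    (h₃ : E₀.a₃ + r * E₀.a₁ + 2 * t = 3 * b₃)
    (h₄ : E₀.a₄ - s * E₀.a₃ + 2 * r * E₀.a₂ - (t + r * s) * E₀.a₁ + 3 * r ^ 2 - 2 * s * t = 3 * b₄)
    (h₆ : E₀.a₆ + r * E₀.a₄ + r ^ 2 * E₀.a₂ + r ^ 3 - t * E₀.a₃ - t ^ 2 - r * t * E₀.a₁ = 3 * b₆)
    (hb : ¬ (3 : ℤ) ∣ b₂ - 2)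
    -- lane data
    (hr : W.analyticRank = 0) (htam : ¬ 3 ∣ W.tamagawaProduct)
    (hmult : ∀ (ℓ : ℕ) [Fact ℓ.Prime], W.HasMultiplicativeReductionAtPrime ℓ →
      (W.HasSplitMultiplicativeReductionAtPrime ℓ → ¬ 3 ∣ ℓ - 1) ∧
        (¬ W.HasSplitMultiplicativeReductionAtPrime ℓ → ¬ 3 ∣ ℓ + 1))
    {N : ℕ} [NeZero N] (D : ModularParametrizationData W N) (hc : ¬ (3 : ℤ) ∣ D.maninConstant)
    {q : ℚ} (hq : shaAn W = (q : ℂ)) (hv : padicValRat 3 q = 0) :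
    haveI : Fact (Nat.Prime 3) := ⟨Nat.prime_three⟩
    BSDp W 3 := by
  haveI : Fact (Nat.Prime 3) := ⟨Nat.prime_three⟩
  have hX : ClassX4M W 3 :=
    classX4M_of_intModel_of_surj hI 3 (by norm_num) hΔ3 hc₄3 k hck hΔk hsurj
  exact hX.bsdp_three_rankZero_of_kimNakamura_of_surj_of_shaAn_unit hKN hGZK hmod hsurj hr
    (nonExceptional_three_of_intModel hI r s t b₁ b₂ b₃ b₄ b₆ h₁ h₂ h₃ h₄ h₆ hb) hmult D hc htam hq hv

/-- **RECORD SHAPE (A153′ road + Cassels–Tate parity, defect `≤ 1`), `p = 3`.** As above with the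
`(ℓ ∓ 1)` clause REPLACED by the defect data: a finite `S ⊇` multiplicative primes, `d : ℕ → ℕ` with
`ord₃(ℓ − 1) ≤ d ℓ` at split / `ord₃(ℓ + 1) ≤ d ℓ` at non-split multiplicative `ℓ`, `Σ_{ℓ ∈ S} d ℓ ≤ 1`;
plus `hCT`. Named facts: `hKNI` (A153′), `hGZK`, `hmod`, `hCT`. Per pair; nothing booked.
[cite: KimNakamura2020, Rem. 1.8 (4) and Rem. 1.8 (1) with Thm. 1.7 (arXiv p. 4); Assumption 2.5 (arXiv p. 5)]
[cite: SilvermanAEC2009, Thm. X.4.14, VII.5 Prop. 5.1 (c) and III.1] [cite: Miller2011LMS, §1 and Def. 1.1] -/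
theorem bsdp_three_of_intModel_of_surj_of_kimNakamuraImprimitive_of_defect_le_one_of_shaAn_unit
    (hI : integralModelInt W = E₀)
    (hKNI : KimNakamura2020.rankZero_padicValNat_sha_le_imprimitive_of_maninConstant)
    (hGZK : rank_eq_analyticRank_of_analyticRank_le_one) (hmod : hasEntireLFunction_rat)
    (hCT : exists_casselsTate_pairing (K := ℚ))
    (hΔ3 : (3 : ℤ) ∣ E₀.Δ) (hc₄3 : (3 : ℤ) ∣ E₀.c₄) (k : ℕ) (hck : ¬ (3 : ℤ) ^ (k + 1) ∣ E₀.c₄ ^ 3)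
    (hΔk : (3 : ℤ) ^ (k + 1) ∣ E₀.Δ) (hsurj : W.HasSurjectiveModNGaloisRep 3)
    (r s t b₁ b₂ b₃ b₄ b₆ : ℤ)
    (h₁ : E₀.a₁ + 2 * s = 3 * b₁)
    (h₂ : E₀.a₂ - s * E₀.a₁ + 3 * r - s ^ 2 = 3 * b₂)
    (h₃ : E₀.a₃ + r * E₀.a₁ + 2 * t = 3 * b₃)
    (h₄ : E₀.a₄ - s * E₀.a₃ + 2 * r * E₀.a₂ - (t + r * s) * E₀.a₁ + 3 * r ^ 2 - 2 * s * t = 3 * b₄)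
    (h₆ : E₀.a₆ + r * E₀.a₄ + r ^ 2 * E₀.a₂ + r ^ 3 - t * E₀.a₃ - t ^ 2 - r * t * E₀.a₁ = 3 * b₆)
    (hb : ¬ (3 : ℤ) ∣ b₂ - 2)
    (hr : W.analyticRank = 0) (htam : ¬ 3 ∣ W.tamagawaProduct)
    {N : ℕ} [NeZero N] (D : ModularParametrizationData W N) (hc : ¬ (3 : ℤ) ∣ D.maninConstant)
    (S : Finset ℕ) (d : ℕ → ℕ)
    (hS : ∀ (ℓ : ℕ) [Fact ℓ.Prime], W.HasMultiplicativeReductionAtPrime ℓ →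
      ℓ ∈ S ∧ (W.HasSplitMultiplicativeReductionAtPrime ℓ → padicValNat 3 (ℓ - 1) ≤ d ℓ) ∧
        (¬ W.HasSplitMultiplicativeReductionAtPrime ℓ → padicValNat 3 (ℓ + 1) ≤ d ℓ))
    (hd : ∑ ℓ ∈ S, d ℓ ≤ 1) {q : ℚ} (hq : shaAn W = (q : ℂ)) (hv : padicValRat 3 q = 0) :
    haveI : Fact (Nat.Prime 3) := ⟨Nat.prime_three⟩
    BSDp W 3 := by
  haveI : Fact (Nat.Prime 3) := ⟨Nat.prime_three⟩
  have hX : ClassX4M W 3 :=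
    classX4M_of_intModel_of_surj hI 3 (by norm_num) hΔ3 hc₄3 k hck hΔk hsurj
  exact hX.bsdp_three_rankZero_of_kimNakamuraImprimitive_of_surj_of_defect_le_one_of_shaAn_unit hKNI
    hGZK hmod hCT hsurj hr (nonExceptional_three_of_intModel hI r s t b₁ b₂ b₃ b₄ b₆ h₁ h₂ h₃ h₄ h₆ hb)
    htam D hc S d hS hd hq hv

end RecordShape

/-! ### §3 One worked instance of the decidable part: Cremona `1098c1` -/

section Instance1098c1

variable {W : WeierstrassCurve ℚ} [W.IsElliptic] [W.IsGloballyMinimal]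

omit [W.IsElliptic] in
/-- **`1098c1 = [1, −1, 0, −63864, 6229696]` is NOT exceptional at `3`**: translate
`(r, s, t) = (2, 1, 2)` gives `(b₁, b₂, b₃, b₄, b₆) = (1, 1, 2, −21288, 2033988)`, `b₂ = 1 ≢ 2 (mod 3)`.
[cite: KimNakamura2020, Assumption 2.5 with (2.1) (arXiv p. 5)] [cite: KostersPannekoek2017, Cor. 2] -/
theorem nonExceptional_three_v1098c1 (hI : integralModelInt W = ⟨1, -1, 0, -63864, 6229696⟩) :
    KimNakamura2020.NonExceptional W 3 :=
  nonExceptional_three_of_intModel hI 2 1 2 1 1 2 (-21288) 2033988 (by norm_num) (by norm_num)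
    (by norm_num) (by norm_num) (by norm_num) (by decide)

/-- **`ord₃ j(1098c1) = −13`** (`3² ∥ c₄ = 3065481`, `3¹⁹ ∥ Δ = −2⁷·3¹⁹·61`), so `3 ∤ ord₃ j` — the
kernel-surj bit of the (M) theorems. [cite: SilvermanAEC2009, III.1 (p. 42)] -/
theorem padicValRat_j_three_v1098c1 (hI : integralModelInt W = ⟨1, -1, 0, -63864, 6229696⟩) :
    haveI : Fact (Nat.Prime 3) := ⟨Nat.prime_three⟩
    padicValRat 3 W.j = -13 := by
  haveI : Fact (Nat.Prime 3) := ⟨Nat.prime_three⟩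
  have h := padicValRat_j_eq_of_intModel hI 3 2 19 (by decide +kernel) (by decide +kernel)
    (by decide +kernel) (by decide +kernel)
  rw [h]; norm_num

/-- **`ClassX4M W 3` for `1098c1`** (`N = 1098 = 2·3²·61`; `3 ∣ Δ`, `3 ∣ c₄`, `3⁷ ∤ c₄³`, `3⁷ ∣ Δ`),
GIVEN `ρ̄_{E,3}` onto (`hsurj`; Cremona galrep: no `3`-code). No BSD statement for the curve is
asserted here — its `r_an = 0`, `∏c_ℓ = 2`, defect `D = 1` and `#Ш_an = 1` are lane data (census row
`census-g18/KN20-IMPRIMITIVE-M3.tsv`), to be displayed as binders of §2 by a records seat.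
[cite: SilvermanAEC2009, VII.5 Prop. 5.1 (c) and III.1] -/
theorem classX4M_three_v1098c1 (hI : integralModelInt W = ⟨1, -1, 0, -63864, 6229696⟩)
    (hsurj : W.HasSurjectiveModNGaloisRep 3) :
    haveI : Fact (Nat.Prime 3) := ⟨Nat.prime_three⟩
    ClassX4M W 3 :=
  haveI : Fact (Nat.Prime 3) := ⟨Nat.prime_three⟩
  classX4M_of_intModel_of_surj hI 3 (by norm_num) (by decide +kernel) (by decide +kernel) 6
    (by decide +kernel) (by decide +kernel) hsurj

end Instance1098c1

end Summit.BirchSwinnertonDyer.Rank1Residual.AdditivePotMult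

end
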